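import Literature.NumberTheory.DiophantineGeometry.CafureMatera
import Literature.NumberTheory.DiophantineGeometry.PlaneSectionRationalPointProofs
import Literature.NumberTheory.DiophantineGeometry.BertiniSpecializationProofs
import Literature.NumberTheory.DiophantineGeometry.BertiniSeparabilityProofs
import HarnessLib

/-!
# Proof of Cafure–Matera (2006), Theorem 5.4: rational zeros for `q > 2δ⁴`

We discharge `CafureMatera2006_thm54`: an absolutely irreducible `f ∈ 𝔽_q[x₁, …, xₙ]` of degree
`δ` with `2δ⁴ < q` has an `𝔽_q`-rational zero. The proof follows the printed one (Finite Fields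
Appl. 12 (2006), proof of Thm. 5.4, p. 174: "an effective Bertini theorem (Cor. 3.4) gives a plane
`L` defined over `𝔽_q` such that `f_L` is an absolutely irreducible plane curve of degree `δ` …
Weil's estimate (1) yields a `q`-rational point"), with Kaltofen's effective Hilbert irreducibility
theorem [Kal95, Thm. 5] supplying the Bertini step:

1. (`BertiniDirectionProofs`) a direction `v ∈ 𝔽_qⁿ` with `f_δ(v) ≠ 0` and `D_v f ≠ 0`
   (`δ + 1 < q`);
2. (`BertiniSeparabilityProofs`) a base point `μ ∈ 𝔽_qⁿ` with `g(T) = f(μ + Tv)` separable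
   (`(2δ-1)δ < q`), hence a simple root `α ∈ 𝔽̄_q` of `g`;
3. (`BertiniSubstitutionProofs`, `BertiniShapeProofs`) the generic plane section
   `χ = f(μ + vX + Y·Z) ∈ 𝔽̄_q[Z][Y][X]` is irreducible of the right shape, `χ(X, 0, Z) = g(X)`;
4. (`BertiniSpecializationProofs`) Kaltofen's certificate `Υ ∈ 𝔽̄_q[Z]`, `Υ ≠ 0`,
   `deg Υ ≤ δ²(2δ² - δ) < 2δ⁴ < q`, with `χ(X, Y, γ)` irreducible over `𝔽̄_q` whenever `Υ(γ) ≠ 0`;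
   a non-root `γ ∈ 𝔽_qⁿ` exists by the Schwartz–Zippel bound (CM Lemma 2.1);
5. (`PlaneSectionRationalPointProofs`) the plane section `Y ↦ f(μ + γ X + v Y)` over `𝔽_q` is then
   absolutely irreducible of degree `δ` with `f_δ(v) ≠ 0`, and Weil's bound for its function field
   (`q + 1 - 2g√q` rational places, `2g ≤ (δ-1)(δ-2)`, at most `δ` of them at infinity) leaves an
   affine `𝔽_q`-point since `δ + (δ-1)(δ-2)√q < q + 1` for `2δ⁴ < q`.

## References

* A. Cafure, G. Matera, Improved explicit estimates on the number of solutions of equations over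
  a finite field, Finite Fields Appl. 12 (2006) 155–185, Thm. 5.4 (and §3, Cor. 3.4).
  [CafureMatera2006]
* E. Kaltofen, Effective Noether irreducibility forms and applications, J. Comput. System Sci.
  50 (1995) 274–295, Thm. 5. [Kaltofen1995]
-/

noncomputable section

open scoped Classical Polynomial Polynomial.Bivariate
open Polynomial

namespace Literature.NumberTheory.DiophantineGeometry

universe u v

section Transport

variable {K : Type u} [Field K] {n : ℕ}

/-- Base change of the line restriction: `(map σ f)(σμ + T σv) = σ(f(μ + Tv))`. [folklore] -/
theorem aeval_affine_map_eq {L : Type v} [Field L] (σ : K →+* L) (f : MvPolynomial (Fin n) K)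
    (μ v : Fin n → K) {μ' v' : Fin n → L} (hμ : μ' = σ ∘ μ) (hv : v' = σ ∘ v) :
    MvPolynomial.aeval (fun i ↦ C (μ' i) + C (v' i) * X : Fin n → L[X])
        (MvPolynomial.map σ f) =
      (MvPolynomial.aeval (fun i ↦ C (μ i) + C (v i) * X : Fin n → K[X]) f).map σ := by
  subst hμ hv
  have h : (MvPolynomial.aeval (R := L) (fun i ↦ C ((σ ∘ μ) i) + C ((σ ∘ v) i) * X :
        Fin n → L[X])).toRingHom.comp (MvPolynomial.map σ) =
      (mapRingHom σ).comp (MvPolynomial.aeval (R := K)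
        (fun i ↦ C (μ i) + C (v i) * X : Fin n → K[X])).toRingHom := by
    refine MvPolynomial.ringHom_ext (fun c ↦ ?_) (fun i ↦ ?_)
    · simp
    · simp
  exact congrArg (fun φ : MvPolynomial (Fin n) K →+* L[X] ↦ φ f) h

/-- **Specializing the generic plane section at an `𝔽_q`-rational parameter:** for `γ ∈ Kⁿ`,
`χ(X, Y, σγ)` (with `χ = (map σ f)(σμ + σv X + Y·Z) ∈ L[Z][Y][X]`) is the base change to `L` of
the `K`-rational plane section `f(μ + γ X + v Y) ∈ K[X][Y]` (outer variable `Y ↔` the `X` of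
`χ`, inner variable `X ↔` the `Y` of `χ`). [folklore] -/
theorem map_planeSubst_eval_eq {L : Type v} [Field L] (σ : K →+* L) (f : MvPolynomial (Fin n) K)
    (μ v γ : Fin n → K) {μ' v' : Fin n → L} (hμ : μ' = σ ∘ μ) (hv : v' = σ ∘ v) :
    (MvPolynomial.aeval (fun i ↦
      (Polynomial.C (Polynomial.C (MvPolynomial.C (μ' i))) +
        Polynomial.C (Polynomial.C (MvPolynomial.C (v' i))) * Polynomial.X +
        Polynomial.C (Polynomial.C (MvPolynomial.X i) * Polynomial.X) :
          Polynomial (Polynomial (MvPolynomial (Fin n) L)))) (MvPolynomial.map σ f)).map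
        (mapRingHom (MvPolynomial.eval (σ ∘ γ))) =
      (MvPolynomial.aeval (fun i ↦ C (C (v i)) * Y + C (C (μ i) + C (γ i) * X) :
        Fin n → K[X][Y]) f).map (mapRingHom σ) := by
  subst hμ hv
  have h : (mapRingHom (mapRingHom (MvPolynomial.eval (σ ∘ γ)))).comp
        ((MvPolynomial.aeval (R := L) (fun i ↦
          (Polynomial.C (Polynomial.C (MvPolynomial.C ((σ ∘ μ) i))) +
            Polynomial.C (Polynomial.C (MvPolynomial.C ((σ ∘ v) i))) * Polynomial.X +
            Polynomial.C (Polynomial.C (MvPolynomial.X i) * Polynomial.X) :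
              Polynomial (Polynomial (MvPolynomial (Fin n) L))))).toRingHom.comp
          (MvPolynomial.map σ)) =
      (mapRingHom (mapRingHom σ)).comp (MvPolynomial.aeval (R := K)
        (fun i ↦ C (C (v i)) * Y + C (C (μ i) + C (γ i) * X) : Fin n → K[X][Y])).toRingHom := by
    refine MvPolynomial.ringHom_ext (fun c ↦ ?_) (fun i ↦ ?_)
    · simp [Polynomial.algebraMap_apply, MvPolynomial.algebraMap_eq]
    · simp only [RingHom.coe_comp, Function.comp_apply, MvPolynomial.map_X, AlgHom.toRingHom_eq_coe,
        RingHom.coe_coe, MvPolynomial.aeval_X, coe_mapRingHom, Polynomial.map_add,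
        Polynomial.map_mul, Polynomial.map_C, Polynomial.map_X, MvPolynomial.eval_C,
        MvPolynomial.eval_X, Polynomial.C_add]
      ring
  exact congrArg (fun φ : MvPolynomial (Fin n) K →+* _ ↦ φ f) h

end Transport

/-! ### The theorem -/

/-- **Cafure–Matera (2006), Theorem 5.4.** "For `q > 2δ⁴`, any absolutely irreducible
`𝔽_q`–hypersurface of degree `δ` has a `q`–rational zero."
[cite: CafureMatera2006, Thm. 5.4] [cite: Kaltofen1995, Thm. 5] -/
theorem CafureMatera2006_thm54_holds : CafureMatera2006_thm54 := by
  intro K _ _ n f hf hq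
  set Kbar := AlgebraicClosure K with hKbar
  set σ : K →+* Kbar := algebraMap K Kbar with hσ
  have hf' : Irreducible (MvPolynomial.map σ f) := hf
  set δ := f.totalDegree with hδ
  have hirrK : Irreducible f := irreducible_of_irreducible_mvPolynomial_map σ hf'
  -- `δ ≥ 1`: a nonzero constant is a unit
  have hδ1 : 1 ≤ δ := by
    by_contra h0
    have h0' : f.totalDegree = 0 := by omega
    rw [MvPolynomial.totalDegree_eq_zero_iff_eq_C] at h0'
    have hc : f.coeff 0 ≠ 0 := by
      intro hc
      apply hirrK.ne_zero
      rw [h0', hc, map_zero]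
    exact hirrK.not_isUnit (by rw [h0']; exact (isUnit_iff_ne_zero.2 hc).map MvPolynomial.C)
  -- numerics from `2δ⁴ < q`
  have h4 : δ ≤ δ ^ 4 := Nat.le_self_pow (by norm_num) δ
  have hq1 : δ + 1 < Fintype.card K := by linarith
  have hq2 : (δ + (δ - 1)) * δ < Fintype.card K := by
    have h1 : δ + (δ - 1) ≤ 2 * δ := by omega
    have h2 : δ ^ 2 ≤ δ ^ 4 := Nat.pow_le_pow_right hδ1 (by norm_num)
    have h3 : (δ + (δ - 1)) * δ ≤ 2 * δ ^ 4 :=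
      calc (δ + (δ - 1)) * δ ≤ 2 * δ * δ := Nat.mul_le_mul_right δ h1
        _ = 2 * δ ^ 2 := by ring
        _ ≤ 2 * δ ^ 4 := Nat.mul_le_mul_left 2 h2
    exact lt_of_le_of_lt h3 hq
  have hq3 : δ ^ 2 * (2 * δ ^ 2 - δ) < Fintype.card K := by
    have h3 : δ ^ 2 * (2 * δ ^ 2 - δ) ≤ 2 * δ ^ 4 :=
      calc δ ^ 2 * (2 * δ ^ 2 - δ) ≤ δ ^ 2 * (2 * δ ^ 2) := Nat.mul_le_mul_left _ (Nat.sub_le _ _)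
        _ = 2 * δ ^ 4 := by ring
    exact lt_of_le_of_lt h3 hq
  -- Step 1: a good direction `v`
  obtain ⟨v, hv, hD⟩ := exists_good_direction σ hf' hq1
  -- Step 2: a base point `μ` with `g = f(μ + Tv)` separable, and a simple root `α ∈ K̄` of `g`
  obtain ⟨μ, hcop⟩ := exists_isCoprime_lineSpecialization hirrK hv hD hq2
  set g : K[X] := MvPolynomial.aeval
    (fun i ↦ Polynomial.C (μ i) + Polynomial.C (v i) * Polynomial.X : Fin n → K[X]) f with hg
  have hgcoeff : g.coeff δ =
      MvPolynomial.eval v (MvPolynomial.homogeneousComponent δ f) :=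
    coeff_map_eval_lineRestrict_totalDegree f μ v
  have hgdegle : g.natDegree ≤ δ := natDegree_map_eval_lineRestrict_le f μ v
  have hgdeg : g.natDegree = δ :=
    le_antisymm hgdegle (le_natDegree_of_ne_zero (by rw [hgcoeff]; exact hv))
  have hg0 : g ≠ 0 := fun h ↦ by rw [h, natDegree_zero] at hgdeg; omega
  obtain ⟨α, hα, hα'⟩ := exists_root_derivative_ne_zero σ hcop (by rw [hgdeg]; omega)
  -- Step 3: the generic plane section `χ` over `K̄` and its shape
  set μ' : Fin n → Kbar := σ ∘ μ with hμ'
  set v' : Fin n → Kbar := σ ∘ v with hv'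
  have hFdeg : (MvPolynomial.map σ f).totalDegree = δ := totalDegree_map_of_injective f σ.injective
  have hgbar : MvPolynomial.aeval (fun i ↦ C (μ' i) + C (v' i) * X : Fin n → Kbar[X])
      (MvPolynomial.map σ f) = g.map σ := aeval_affine_map_eq σ f μ v hμ' hv'
  have hgbar0 : MvPolynomial.aeval (fun i ↦ C (μ' i) + C (v' i) * X : Fin n → Kbar[X])
      (MvPolynomial.map σ f) ≠ 0 := by
    rw [hgbar]
    exact (Polynomial.map_ne_zero_iff σ.injective).2 hg0
  have hirrχ := irreducible_planeSubst hf' μ' v' hgbar0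
  have hdegle := natDegree_planeSubst_le (MvPolynomial.map σ f) μ' v'
  have hcoeff := coeff_planeSubst_totalDegree (MvPolynomial.map σ f) μ' v'
  have htd := coeff_coeff_planeSubst_eq_zero (MvPolynomial.map σ f) μ' v'
  have hfil := filtration_planeSubst (MvPolynomial.map σ f) μ' v'
  have hred := map_evalRingHom_zero_planeSubst (MvPolynomial.map σ f) μ' v'
  rw [hFdeg] at hdegle hcoeff htd
  rw [hgbar] at hred
  set c := MvPolynomial.eval v (MvPolynomial.homogeneousComponent δ f) with hc
  have hcbar : MvPolynomial.eval v' (MvPolynomial.homogeneousComponent δ (MvPolynomial.map σ f)) =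
      σ c := by
    rw [homogeneousComponent_map, MvPolynomial.eval_map, hv', hc]
    show MvPolynomial.eval₂ σ (σ ∘ v) _ = σ (MvPolynomial.eval₂ (RingHom.id K) v _)
    rw [MvPolynomial.eval₂_comp_left σ (RingHom.id K) v, RingHom.comp_id]
  have hσc : σ c ≠ 0 := (map_ne_zero σ).2 hv
  rw [hcbar] at hcoeff
  have hdegχ := le_antisymm hdegle (le_natDegree_of_ne_zero (by
    rw [hcoeff]
    exact Polynomial.C_ne_zero.2 (MvPolynomial.C_ne_zero.2 hσc)))
  have hleadχ := hcoeff
  rw [← hdegχ, coeff_natDegree] at hleadχ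
  -- Step 4: Kaltofen's certificate and an `𝔽_q`-rational non-root `γ`
  obtain ⟨Υ, hΥ0, hΥdeg, hΥirr⟩ :=
    exists_irreducibility_certificate hδ1 hdegχ hσc hleadχ hirrχ htd hfil hred hα hα'
  obtain ⟨γ, hγ⟩ :=
    exists_eval_comp_ne_zero_of_totalDegree_lt_card σ hΥ0 (hΥdeg.trans_lt hq3)
  have hI := hΥirr (σ ∘ γ) hγ
  rw [map_planeSubst_eval_eq σ f μ v γ hμ' hv'] at hI
  -- Step 5: Weil's bound on the good plane section
  exact exists_eval_eq_zero_of_planeSection f σ v (fun i ↦ C (μ i) + C (γ i) * X)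
    (fun i ↦ (natDegree_add_le _ _).trans (max_le (by rw [natDegree_C]; exact Nat.zero_le _)
      ((natDegree_C_mul_le _ _).trans natDegree_X_le))) hv hI hq

end Literature.NumberTheory.DiophantineGeometry
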